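import Summits.BirchSwinnertonDyer.BirchSwinnertonDyer.Theorems.ErratumRoadFiveKolyvaginRestTam
import Summits.BirchSwinnertonDyer.BirchSwinnertonDyer.Theorems.KolyvaginRoadThreePointCertificate
import Summits.BirchSwinnertonDyer.BirchSwinnertonDyer.Theorems.KolyvaginRoadThreeLevelData
import Summits.BirchSwinnertonDyer.Rank1Residual.X11b.BDPRouteRigidity
import Literature.NumberTheory.EllipticCurves.KolyvaginShaStructureDivisibility
import Literature.NumberTheory.EllipticCurves.HeegnerPointsClassesProofs
import Literature.NumberTheory.EllipticCurves.Rank1Residual.X11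
import HarnessLib

/-!
# Route `ErratumRoadFive` (rung K2a), crux `RamNoErratumDataAtFive` (item stmt-BirchSwinnertonDyer-19624): the
# Kolyvagin hypothesis `hZ` at `p ≥ 5` is TIGHT — `BSD(E,p)` at a Locus pair FORCES a non-zero mod-`p` Kolyvagin
# class at every Hoffstein–Luo frame; hence `hZ₅ ⟺ BSD(E,p) on the Locus` modulo the published inputs, and on
# Skinner–Zhang's locus (a)–(e) `hZ` follows BY CITATION from the preprint's Thm. 1.2
# (cell `bsd-stepL`, seat `bsd-stepL-imc-p1` g5; `--supports stmt-BirchSwinnertonDyer-19624`, helper)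

THEOREMS ONLY (no definition, no named fact, no `sorry`); nothing about Kolyvagin's conjecture and nothing about
`BSD(E,p)` is asserted; every published input is a named fact of the tree taken as a binder; the Skinner–Zhang
binder `thm1_2_padicVal_bsd_rankOne_OPEN` is an UNREFEREED-PREPRINT claim, tagged `_OPEN`, used as a hypothesis.
PARTITION: X11b@p≥5 (B9 ∕ N8) × (α) ∩ Locus (cw 680 724) — types-the-object-of; closes: none.

THE POINT (the `p ≥ 5` twin of zhang3-p1's `KolyvaginRoadThreeCruxIffLeaf.lean`, p-generic ingredients only).
`ErratumRoadFiveKolyvaginKernelHLFive` ∕ `…RestTam` read the Kolyvagin hypothesis FORWARD (`hZ ⟹ BSDp W p ⟹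
P2OpenInputOnTreeAt W p`). This file proves the CONVERSE at a pair from published inputs only — W. Zhang 2014
Remark 5 ∕ Thm. 10.2 read backwards through McCallum 1991 Cor. 5.6 in its divisibility half: `BSD(E,p)` gives
STEP L at the Heegner point of the frame (`indexLowerBoundAt_of_bsdp_of_heegnerData_of_odd`); if every derived
point `P(n)` on the frame were `p`-divisible, McCallum's bound with `M_∞ ≥ 1` would contradict STEP L; a
non-divisible `P(n)` with its `Γ_K`-invariance (McCallum (4), supplied at Zhang–Kolyvagin levels by zhang3-p1's
`KolyCert.toGeomPoints_derivedPoint_mem_invPoints_of_dvd_zhang`, any `p`) and admissibility of `E(K[n])` (Gross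
Lemma 4.3 from `ρ̄_{E,p}` onto, `RingClassNoTorsion.isAdmissible_pointsSubgroup`, any odd `p`) is a non-zero class
(McCallum Cor. 4.5, `KolyCert.kolyvaginClass_ne_zero_iff`). Tower surjectivity at the multiplicative `p` comes from
`Surj ∧ Ram` (`hasSurjectiveModNGaloisRep_pow_of_hasMultiplicativeReductionAtPrime`).

* §1 `Koly.kolyvaginClass_ne_zero_of_tower_not_pDiv_of_surj` — any odd `p`, `ρ̄` onto, `d_K < −4`: a tower
  certificate `p ∤ P(n)` gives `c₁(n) ≠ 0` (port of `KolyCert.kolyvaginClass_three_ne_zero_of_tower_not_pDiv`).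
* §2 `Koly.kolyvaginClass_one_ne_zero_of_bsdp_of_hlFrame_of_five_le` — `BSDp W p` at a Locus pair, `p ≥ 5`, FORCES a
  non-zero class at every Hoffstein–Luo frame (`d_K` odd, `≠ −3`, Heegner, `L(E^{d_K},1) ≠ 0`, `4N ∣ β² − d_K`,
  `p ∤ c(Dt)`).
* §3 `Koly.kolyvaginFramesHL_onLocus_iff_bsdp_onLocus_of_five_le` — class level, modulo the published inputs:
  `hZ₅ ⟺ ∀ W p, ClassX11b W p → 5 ≤ p → Ram W p → p ∤ ∏c → BSDp W p` (the rung leaf on the Locus). So the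
  Kolyvagin part of crux 19624 carries NO SURPLUS over the leaf on its pairs and cannot be refuted without
  refuting the `p`-part of BSD at an (α) ∩ Locus pair.
* §4 `Koly.kolyvaginFramesHLAt_of_skinnerZhang_OPEN` — on Skinner–Zhang's locus (hypotheses (a)–(e) of
  arXiv:1407.1099 Thm. 1.1, `r_an = 1`, `p ≥ 5`) the hypothesis `hZ` at the pair follows BY CITATION from the
  preprint's Thm. 1.2 (`SkinnerZhang2014.thm1_2_padicVal_bsd_rankOne_OPEN`, tree bridge `bsdp_of_skinnerZhang_OPEN`)
  and published inputs — the honest «PRE-covered» certificate for that part of (α) ∩ Locus.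

References (locators only): [cite: WZhang2014, Thm. 1.1, Remark 5 and Thm. 10.2] [cite: McCallumLMS1991, §4 (4)–(5),
Cor. 4.5, §5 Lemma 5.1 and Cor. 5.6] [cite: GrossLMS1991, §3, Lemma 4.3, Prop. 3.6, §4 (4.1)] [cite: Jetchev2008, §1 (1)]
[cite: SkinnerZhang2014, Thm. 1.1 (a)–(e), Thm. 1.2, Thm. 1.3] [cite: HoffsteinLuo1997, main theorem].
-/

noncomputable section

open scoped Classical

namespace Summit.BirchSwinnertonDyer.Rank1Residual.X11b.Three.Koly

open WeierstrassCurve NumberField Literature.NumberTheory.EllipticCurves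
  Literature.NumberTheory.EllipticCurves.ModularForms
  Literature.NumberTheory.EllipticCurves.Rank1Residual
  Literature.NumberTheory.EllipticCurves.KolyvaginCocycle
  Summit.BirchSwinnertonDyer.Rank1Residual Summit.BirchSwinnertonDyer.Rank1Residual.X11b

/-! ## §1 A tower certificate gives a non-zero class, any odd `p` with `ρ̄` onto -/

/-- **A tower certificate gives a NON-ZERO `c₁(n)`, any odd `p` with `ρ̄_{E,p}` onto** (port of zhang3-p1's
`KolyCert.kolyvaginClass_three_ne_zero_of_tower_not_pDiv`). Data: `E = W/ℚ` elliptic, globally minimal; `K` imaginary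
quadratic with the Heegner hypothesis for `N_E` (so `(N_E, d_K) = 1`) and `d_K < −4`; a frame `(Dt, β, ι)`; a
square-free product `n` of Zhang–Kolyvagin primes for `p`; Kolyvagin–Heegner data `d m` at every `m ∣ n`. If `P(n) ∉
p·E(K[n])` then `(d n).kolyvaginClass _ 1 ≠ 0`: invariance mod `p` from the Euler-system relations at Zhang levels
(`KolyCert.toGeomPoints_derivedPoint_mem_invPoints_of_dvd_zhang`, any `p`), admissibility of `E(K[n])` from `Surj W p`
(`RingClassNoTorsion.isAdmissible_pointsSubgroup`, Gross Lemma 4.3), the cocycle by McCallum Cor. 4.5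
(`KolyCert.kolyvaginClass_ne_zero_iff`). [cite: McCallumLMS1991, §4 (4)–(5), Cor. 4.5]
[cite: GrossLMS1991, Prop. 3.6, Lemma 4.3, Prop. 4.7 (1)] -/
theorem kolyvaginClass_ne_zero_of_tower_not_pDiv_of_surj (W : WeierstrassCurve ℚ) [W.IsElliptic]
    [W.IsGloballyMinimal] [NeZero (W.conductorNorm ℤ)] (K : Type) [Field K] [NumberField K]
    (Dt : ModularParametrizationData W (W.conductorNorm ℤ)) (β : ℤ) (ι : K →+* ℂ)
    (p : ℕ) [hp : Fact p.Prime] (hp2 : p ≠ 2) (hsurj : Rank1Residual.Surj W p)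
    (hK : IsImaginaryQuadratic K) (hH : SatisfiesHeegnerHypothesis (W.conductorNorm ℤ) K)
    (hD : NumberField.discr K < -4)
    {n : ℕ} (hn : KolyvaginDescent.KolSupp (Zhang2014.IsKolyvaginPrime (W.conductorNorm ℤ) W K p) n)
    (d : (m : ℕ) → m ∣ n → KolyvaginHeegnerData Dt β ι m)
    (hcert : ¬ PDiv (d n dvd_rfl) p 1) :
    (d n dvd_rfl).kolyvaginClass hp.out 1 ≠ 0 := by
  -- `(N, d_K) = 1` from the Heegner hypothesis
  have hND : IsCoprime (W.conductorNorm ℤ : ℤ) (NumberField.discr K) := by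
    have h := Literature.SatisfiesHeegnerHypothesis.coprime_discr hK.1 hH
    refine Int.isCoprime_iff_gcd_eq_one.mpr ?_
    rw [Int.gcd_eq_natAbs, Int.natAbs_natCast]
    exact h
  have hkol : ∀ q ∈ n.primeFactors,
      Zhang2014.IsKolyvaginPrime (W.conductorNorm ℤ) W K p q ∧ 1 ≤ Zhang2014.kolyvaginIndex W p q :=
    fun q hq ↦ ⟨hn.2 q hq, (hn.2 q hq).2.2.2.2.2⟩
  have hP := KolyCert.toGeomPoints_derivedPoint_mem_invPoints_of_dvd_zhang hK ι Dt hp.out hND hD hn.1 hkol d n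
    dvd_rfl
  have hA : IsAdmissible (Field.absoluteGaloisGroup K) (d n dvd_rfl).pointsSubgroup ((p ^ 1 : ℕ) : ℤ) :=
    RingClassNoTorsion.isAdmissible_pointsSubgroup (d n dvd_rfl) hK hn.1.ne_zero hp.out hp2 hsurj 1
  exact (KolyCert.kolyvaginClass_ne_zero_iff (d n dvd_rfl) hp.out 1).mpr ⟨hA, hP, hcert⟩

/-! ## §2 The converse at ONE Hoffstein–Luo frame, `p ≥ 5` -/

/-- **`BSD(E,p)` at a Locus pair, `p ≥ 5`, FORCES a non-zero mod-`p` Kolyvagin class at every Hoffstein–Luo frame**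
(W. Zhang 2014 Remark 5 ∕ Thm. 10.2 read backwards via McCallum 1991 Cor. 5.6, divisibility half; the `p ≥ 5` twin of
zhang3-p1's `kolyvaginClass_one_ne_zero_of_bsdp_of_hlFrame`). Data: `W/ℚ` globally minimal with `(E,p) ∈ X11b`, `p ≥ 5`,
a (ram) witness and `p ∤ ∏_ℓ c_ℓ(E)`; `K` imaginary quadratic with `d_K` ODD, `d_K ≠ −3`, Heegner for `N_E`,
`L(E^{d_K},1) ≠ 0`; a frame `(Dt, β, ι)` with `4N ∣ β² − d_K` and `p ∤ c(Dt)`. PUBLISHED inputs as binders: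
Gross–Zagier `hGZ`, Kolyvagin `hKo`, Skinner 2016 Thm. C `hSk`, GZK `hGZK`, modularity `hmod`, Shimura reciprocity at
conductor 1 `hrec`, Gross 1991 §3 `h1 h2`, McCallum Cor. 5.6's divisibility half `hMcU`. HYPOTHESIS: `BSDp W p`.
CONCLUSION: some Kolyvagin–Heegner datum `d` of conductor `n` (square-free product of Zhang–Kolyvagin primes, `n = 1`
allowed) on the frame has `c₁(n) ≠ 0`. Tower surjectivity from `Surj ∧ Ram`; `E(K)[p] = 0` from irreducibility;
`d_K < −4` from `d_K` odd, `≠ −3`, `|d_K| > 2`. CONDITIONAL on every binder; nothing is booked.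
[cite: WZhang2014, Remark 5 and Thm. 10.2] [cite: McCallumLMS1991, §5 Lemma 5.1 and Cor. 5.6] [cite: Jetchev2008, §1 (1)] -/
theorem kolyvaginClass_one_ne_zero_of_bsdp_of_hlFrame_of_five_le
    (W : WeierstrassCurve ℚ) [W.IsElliptic] [W.IsGloballyMinimal] [NeZero (W.conductorNorm ℤ)]
    (K : Type) [Field K] [NumberField K]
    (Dt : ModularParametrizationData W (W.conductorNorm ℤ)) (β : ℤ) (ι : K →+* ℂ)
    (p : ℕ) [hp : Fact p.Prime]
    -- published inputs (named facts of the tree)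
    (hGZ : gross_zagier (W.conductorNorm ℤ) W K) (hKo : kolyvagin (W.conductorNorm ℤ) W K)
    (hSk : Skinner2016.thmC_padicValRat_bsd_rank_zero)
    (hGZK : rank_eq_analyticRank_of_analyticRank_le_one) (hmod : hasEntireLFunction_rat)
    (hrec : heegnerPointOfConductor_one_galoisConj (W.conductorNorm ℤ) W K)
    (h1 : phi_heegnerPointOfConductor_mem_range_map_ringClassField (W.conductorNorm ℤ) W K)
    (h2 : exists_generator_ringClassGalOver K)
    (hMcU : McCallum1991_padicValNat_card_sha_primary_add_le_of_globalDivisibility)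
    -- the pair (Locus, p ≥ 5) and the HL frame
    (hX : ClassX11b W p) (hp5 : 5 ≤ p) (hram : Ram W p) (htam : ¬ p ∣ W.tamagawaProduct)
    (hK : IsImaginaryQuadratic K) (hodd : Odd (NumberField.discr K))
    (hH : SatisfiesHeegnerHypothesis (W.conductorNorm ℤ) K)
    (hLt : (W.quadraticTwist (NumberField.discr K : ℚ)).entireLFunction 1 ≠ 0)
    (h3 : NumberField.discr K ≠ -3)
    (hβ : (4 * (W.conductorNorm ℤ : ℤ)) ∣ β ^ 2 - NumberField.discr K) (hc : ¬ (p : ℤ) ∣ Dt.c)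
    -- the hypothesis: the p-part of BSD for E/ℚ
    (hbsd : BSDp W p) :
    ∃ (n : ℕ) (d : KolyvaginHeegnerData Dt β ι n),
      KolyvaginDescent.KolSupp (Zhang2014.IsKolyvaginPrime (W.conductorNorm ℤ) W K p) n ∧
        d.kolyvaginClass hp.out 1 ≠ 0 := by
  have hmult : W.HasMultiplicativeReductionAtPrime p := hX.2.2.1
  have hirr : Irr W p := hX.2.2.2
  have hp2 : p ≠ 2 := by omega
  have hρ : Surj W p := surj_of_irr_of_ram W p hirr hram
  -- tower surjectivity at the multiplicative `p` from `Surj ∧ Ram`; non-CM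
  have hsurj : ∀ m : ℕ, W.HasSurjectiveModNGaloisRep (p ^ m : ℕ) :=
    hasSurjectiveModNGaloisRep_pow_of_hasMultiplicativeReductionAtPrime W p hρ hram
  have hCM : ¬ W.HasCM := not_hasCM_of_hasMultiplicativeReductionAtPrime' W hmult
  -- `p ∣ N` splits in `K`: `p ∤ #𝓞_K^×`; `d_K ∉ {−3, −4}`, `d_K < −4`
  obtain ⟨-, hμ⟩ := not_dvd_discr_and_not_dvd_torsionOrder_of_heegner hK hH hp2
    (dvd_conductorNorm_of_classX11b hX)
  have h4 : NumberField.discr K ≠ -4 := by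
    intro h
    rw [h] at hodd
    exact (Int.not_odd_iff_even.mpr ⟨-2, by norm_num⟩) hodd
  have hDneg : NumberField.discr K < 0 := hK.discr_neg
  have hD : NumberField.discr K < -4 := by
    have habs : 2 < |NumberField.discr K| := NumberField.abs_discr_gt_two (by rw [hK.1]; omega)
    rw [abs_of_neg hDneg] at habs
    rcases hodd with ⟨k, hk⟩
    omega
  -- an oriented Heegner datum `H` with `H.β = β`, and THE Heegner point `P = y_K ∈ E(K)` of the frame (Darmon 3.6)
  obtain ⟨H, hHβ⟩ := exists_heegnerDatum (W.conductorNorm ℤ) hDneg hβ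
  obtain ⟨P, hP⟩ := heegnerPointComplex_mem_range_map_holds (W.conductorNorm ℤ) W K hK hH Dt H ι
  -- a globally minimal model of the quadratic twist by `d_K`
  have hD0 : (NumberField.discr K : ℚ) ≠ 0 := by exact_mod_cast NumberField.discr_ne_zero K
  haveI hEt : (W.quadraticTwist (NumberField.discr K : ℚ)).IsElliptic := W.isElliptic_quadraticTwist hD0
  obtain ⟨Cd, hCd⟩ := hasGlobalMinimalModel_rat_holds (W.quadraticTwist (NumberField.discr K : ℚ))
  haveI := hCd
  -- STEP L at `P` from `BSD(E,p)` (the tree's converse bookkeeping at odd Heegner data)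
  have hL : IndexLowerBoundAt W p K P :=
    indexLowerBoundAt_of_bsdp_of_heegnerData_of_odd W p K Dt H ι P hGZ hKo hSk hGZK hmod hX hram hK hodd hH hP
      hc hμ hLt (Cd • W.quadraticTwist (NumberField.discr K : ℚ)) Cd rfl hbsd
  -- arithmetic of `E(K)`: `y_K` non-torsion (GZ), rank one and `Ш` finite (Kolyvagin), no p-torsion, `p^{M₀} ∥ y_K`
  have hPinf : ¬ IsOfFinAddOrder P :=
    not_isOfFinAddOrder_of_heegner_of_analyticRank_eq_one W (W.conductorNorm ℤ) K Dt H ι P hGZ hmod hX.1 hK hH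
      hLt hP
  obtain ⟨hrank, hSha⟩ := hKo hK hH ⟨Dt, H, ι, hP⟩ hPinf
  haveI : Finite (W.baseChange K).sha := hSha
  have hbot := torsionBy_eq_bot_of_isImaginaryQuadratic_of_hasIrreducibleModPGaloisRep W K hK hp.out hirr
  have hiv : ∀ x : (W.baseChange K).toAffine.Point, p • x = 0 → x = 0 := fun x hx ↦ by
    have hmem : x ∈ AddSubgroup.torsionBy (W.baseChange K).toAffine.Point ((p : ℕ) : ℤ) := by
      rw [mem_torsionBy_iff, natCast_zsmul]
      exact hx
    rw [hbot] at hmem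
    exact hmem
  haveI : Module.Finite ℤ (W.baseChange K).toAffine.Point := (W.baseChange K).module_finite_point_holds
  obtain ⟨M₀, x₀, hx₀, hmax⟩ := exists_pow_smul_eq_and_forall_ne hPinf (p := p) hp.out.two_le
  have hdiv : ∃ Q : (W.baseChange K).toAffine.Point, ((p ^ M₀ : ℕ) : ℤ) • Q = P :=
    ⟨x₀, by rw [natCast_zsmul]; exact hx₀⟩
  have hndiv : ¬ ∃ Q : (W.baseChange K).toAffine.Point, ((p ^ (M₀ + 1) : ℕ) : ℤ) • Q = P := by
    rintro ⟨Q, hQ⟩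
    exact hmax Q (by rw [← natCast_zsmul]; exact hQ)
  -- Kolyvagin–Heegner data at every square-free inert level of the frame (Gross 1991 §3), in particular at 1
  have hKD : ∀ m : ℕ, Squarefree m → (∀ q ∈ m.primeFactors, (Ideal.span {(q : 𝓞 K)}).IsPrime) →
      Nonempty (KolyvaginHeegnerData Dt β ι m) := fun m hm hinert ↦
    Summit.BirchSwinnertonDyer.BirchSwinnertonDyer.Theorems.nonempty_kolyvaginHeegnerData_of_grossCM h1 h2 hK hH
      Dt β ι hβ hm hinert
  obtain ⟨d₁⟩ := hKD 1 squarefree_one (by simp)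
  -- `P(1) = y_K` in `E(K̄)` (Shimura reciprocity at conductor 1)
  have hPd : d₁.toGeomPoints d₁.derivedPoint = toGeomPoints (W.baseChange K) P :=
    KolyvaginBottom.toGeomPoints_derivedPoint_one_eq hrec hK hH hP d₁ hHβ
  -- the two bridges: `ord_p [E(K):ℤP] = M₀` (McCallum Lemma 5.1) and `ord_p #Ш = ord_p #Ш[p^∞]`
  haveI : Finite (AddCommGroup.torsion (W.baseChange K).toAffine.Point) :=
    WeierstrassCurve.finite_torsion_point (W := W.baseChange K)
  obtain ⟨cc, Q, hcQ, hcker⟩ := RankOne.exists_coord_of_mordellWeilRank_eq_one (W.baseChange K) hrank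
  have hidx : padicValNat p (AddSubgroup.zmultiples P).index = M₀ :=
    padicValNat_index_zmultiples_eq_of_divisibility cc Q hcQ hcker hiv P hdiv hndiv
  have hsha : padicValNat p (W.baseChange K).shaOrder =
      padicValNat p (Nat.card (AddCommGroup.primaryComponent (W.baseChange K).sha p)) :=
    padicValNat_shaOrder_eq (W.baseChange K) p
  have htam0 : padicValNat p W.tamagawaProduct = 0 := padicValNat.eq_zero_of_not_dvd htam
  -- STEP L reads `2 M₀ ≤ ord_p #Ш(E/K)[p^∞]`
  have hL' : 2 * M₀ ≤ padicValNat p (Nat.card (AddCommGroup.primaryComponent (W.baseChange K).sha p)) := by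
    unfold IndexLowerBoundAt at hL
    rw [hidx, hsha, htam0] at hL
    omega
  -- suppose every class vanishes; then every derived point of the frame is p-divisible, and McCallum's Cor. 5.6
  -- with `M_∞ ≥ 1` contradicts STEP L
  by_contra hneg
  have hdivall : ∀ (s : ℕ), s ≤ 1 → ∀ (n : ℕ) (d : KolyvaginHeegnerData Dt β ι n), Squarefree n →
      (∀ ℓ ∈ n.primeFactors, Zhang2014.IsKolyvaginPrime (W.conductorNorm ℤ) W K p ℓ ∧
        s ≤ Zhang2014.kolyvaginIndex W p ℓ) →
      ∃ Q : (W.baseChange (ringClassField K ι n)).toAffine.Point, ((p ^ s : ℕ) : ℤ) • Q = d.derivedPoint := by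
    intro s hs n dn hn hℓ
    rcases Nat.eq_zero_or_pos s with rfl | hs1
    · exact ⟨dn.derivedPoint, by simp⟩
    · obtain rfl : s = 1 := le_antisymm hs hs1
      have hsupp : KolyvaginDescent.KolSupp (Zhang2014.IsKolyvaginPrime (W.conductorNorm ℤ) W K p) n :=
        ⟨hn, fun q hq ↦ (hℓ q hq).1⟩
      have hinert : ∀ m : ℕ, m ∣ n → ∀ q ∈ m.primeFactors, (Ideal.span {(q : 𝓞 K)}).IsPrime :=
        fun m hm q hq ↦ (hsupp.2 q (Nat.primeFactors_mono hm hn.ne_zero hq)).2.2.2.2.1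
      let d : (m : ℕ) → m ∣ n → KolyvaginHeegnerData Dt β ι m := fun m hm ↦
        if h : m = n then h ▸ dn else Classical.choice (hKD m (hn.squarefree_of_dvd hm) (hinert m hm))
      have hdn : d n dvd_rfl = dn := by
        show (if h : n = n then h ▸ dn else _) = dn
        rw [dif_pos rfl]
      by_contra hnd
      have hcert : ¬ PDiv (d n dvd_rfl) p 1 := by rwa [hdn]
      have hne := kolyvaginClass_ne_zero_of_tower_not_pDiv_of_surj W K Dt β ι p hp2 hρ hK hH hD hsupp d hcert
      rw [hdn] at hne
      exact hneg ⟨n, dn, hsupp, hne⟩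
  have hineq := hMcU W hCM K hK h3 h4 hH p hp2 hsurj Dt β ι d₁ P hPd hPinf M₀ hdiv hndiv 1 hdivall
  omega

/-! ## §3 Class level: the Kolyvagin hypothesis on the Locus ⟺ the leaf on the Locus, modulo published inputs -/

/-- **`hZ₅ ⟺ BSD(E,p)` on the whole Locus at `p ≥ 5`, modulo the published inputs.** Granted the published named facts
(Gross–Zagier, Kolyvagin ×2, Skinner 2016 Thm C, GZK, modularity, newforms, Hoffstein–Luo, Mazur's Manin constant,
Shimura reciprocity at conductor 1, Gross 1991 §3 ×2, Darmon Thm. 3.6, BOTH halves of McCallum 1991 Cor. 5.6), the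
∀-frame ♯ Kolyvagin hypothesis at Hoffstein–Luo fields on the Locus (`hZ₅` of `Koly.bsdp_onLocus_of_kolyvaginFramesHL_of_darmon36`)
holds IF AND ONLY IF `BSDp W p` holds at every X11b pair with `p ≥ 5`, a (ram) witness and `p ∤ ∏ c_ℓ` — the rung
leaf `X11b.MultiplicativeRankOne` restricted to the Locus. (⟹) the HL kernel; (⟸) §2 frame by frame. So the
Kolyvagin part of crux 19624 carries NO surplus over the leaf on its pairs. CONDITIONAL on every binder; nothing
booked. [cite: WZhang2014, Thm. 1.1, Remark 5 and Thm. 10.2] [cite: McCallumLMS1991, §5 Cor. 5.6 (both halves)]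
[cite: Darmon2004, Thm. 3.6] [cite: GrossLMS1991, §3 and §4 (4.1)] -/
theorem kolyvaginFramesHL_onLocus_iff_bsdp_onLocus_of_five_le
    (hGZ : ∀ (N : ℕ) [NeZero N] (W : WeierstrassCurve ℚ) (K : Type) [Field K] [NumberField K],
      gross_zagier N W K)
    (hKo : ∀ (N : ℕ) [NeZero N] (W : WeierstrassCurve ℚ) (K : Type) [Field K] [NumberField K],
      kolyvagin N W K)
    (hB : ∀ (N : ℕ) [NeZero N] (W : WeierstrassCurve ℚ) (K : Type) [Field K] [NumberField K],
      Kolyvagin1990_padicValNat_card_sha_le N W K)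
    (hSk : Skinner2016.thmC_padicValRat_bsd_rank_zero)
    (hGZK : rank_eq_analyticRank_of_analyticRank_le_one) (hmod : hasEntireLFunction_rat)
    (hnf : exists_isNewformOf) (hHL : HoffsteinLuo1997_exists_twist_L_one_ne_zero)
    (hMaz : mazur_not_dvd_maninConstant_of_odd)
    (hrec : ∀ (N : ℕ) [NeZero N] (W : WeierstrassCurve ℚ) (K : Type) [Field K] [NumberField K],
      heegnerPointOfConductor_one_galoisConj N W K)
    (h1 : ∀ (N : ℕ) [NeZero N] (W : WeierstrassCurve ℚ) (K : Type) [Field K] [NumberField K],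
      phi_heegnerPointOfConductor_mem_range_map_ringClassField N W K)
    (h2 : ∀ (K : Type) [Field K] [NumberField K], exists_generator_ringClassGalOver K)
    (h36 : ∀ (N : ℕ) [NeZero N] (W : WeierstrassCurve ℚ) (K : Type) [Field K] [NumberField K],
      phi_heegnerTau_mem_range_map_singularModuliField N W K)
    (hMc : McCallum1991_pow_dvd_card_sha_primary_of_certificate)
    (hMcU : McCallum1991_padicValNat_card_sha_primary_add_le_of_globalDivisibility) :
    (∀ (W : WeierstrassCurve ℚ) [W.IsElliptic] [W.IsGloballyMinimal] [NeZero (W.conductorNorm ℤ)]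
      (p : ℕ) [hp : Fact p.Prime] (K : Type) [Field K] [NumberField K]
      (Dt : ModularParametrizationData W (W.conductorNorm ℤ)) (β : ℤ) (ι : K →+* ℂ),
      ClassX11b W p → 5 ≤ p → W.HasMultiplicativeReductionAtPrime p → Rank1Residual.Surj W p →
      Rank1Residual.Ram W p → ¬ p ∣ W.tamagawaProduct →
      IsImaginaryQuadratic K → Odd (NumberField.discr K) →
      SatisfiesHeegnerHypothesis (W.conductorNorm ℤ) K →
      (W.quadraticTwist (NumberField.discr K : ℚ)).entireLFunction 1 ≠ 0 →
      NumberField.discr K ≠ -3 →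
      (4 * (W.conductorNorm ℤ : ℤ)) ∣ β ^ 2 - NumberField.discr K → ¬ (p : ℤ) ∣ Dt.c →
      ∃ (n : ℕ) (d : KolyvaginHeegnerData Dt β ι n),
        KolyvaginDescent.KolSupp (Zhang2014.IsKolyvaginPrime (W.conductorNorm ℤ) W K p) n ∧
          d.kolyvaginClass hp.out 1 ≠ 0) ↔
    (∀ (W : WeierstrassCurve ℚ) [W.IsElliptic] [W.IsGloballyMinimal] (p : ℕ) [Fact p.Prime],
      ClassX11b W p → 5 ≤ p → Rank1Residual.Ram W p → ¬ p ∣ W.tamagawaProduct → BSDp W p) := by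
  constructor
  · intro hZ₅ W _ _ p _ hX hp5 hram htam
    exact bsdp_onLocus_of_kolyvaginFramesHL_of_darmon36 hGZ hKo hB hSk hGZK hmod hnf hHL hMaz hrec hMc h36 hZ₅ W p hX
      hp5 hram htam
  · intro hbsd W _ _ _ p _ K _ _ Dt β ι hX hp5 _ _ hram htam hK hodd hH hLt h3 hβ hc
    exact kolyvaginClass_one_ne_zero_of_bsdp_of_hlFrame_of_five_le W K Dt β ι p (hGZ _ W K) (hKo _ W K) hSk hGZK
      hmod (hrec _ W K) (h1 _ W K) (h2 K) hMcU hX hp5 hram htam hK hodd hH hLt h3 hβ hc (hbsd W p hX hp5 hram htam)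

/-! ## §4 On Skinner–Zhang's locus the hypothesis follows by citation from the preprint's Thm. 1.2 -/

/-- **On Skinner–Zhang's locus, `hZ` at the pair follows BY CITATION from arXiv:1407.1099 Thm. 1.2 (PREPRINT, `_OPEN`).**
For `(E,p) ∈ X11b` with `p ≥ 5`, `p ∤ ∏ c_ℓ`, satisfying hypotheses (a)–(e) of Skinner–Zhang Thm. 1.1
(`SkinnerZhang2014.Hypotheses W p`: multiplicative `p`, `p ∤ v_p(Δ)` and the `𝓛`-clause at split `p`, `E[p]` irreducible,
ramification at the `ℓ ∥ N` with `ℓ ≡ ±1 (mod p)`, two ramified `ℓ ∥ N` — so a (ram) witness, `Hypotheses.exists_ramified_ne`):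
IF the preprint's Thm. 1.2 holds as transcribed (`thm1_2_padicVal_bsd_rankOne_OPEN`, hypothesis `hSZ`), then — with the
published inputs of §2 — every Hoffstein–Luo frame of the pair carries a non-zero mod-`p` Kolyvagin class: `BSDp W p` by
the tree bridge `bsdp_of_skinnerZhang_OPEN`, then §2. This is the honest sense in which the Kolyvagin part of crux 19624 is
«PRE-covered» on SZ14's locus. CONDITIONAL on the `_OPEN` claim and every binder; nothing booked.
[claim: SkinnerZhang2014, status: under-review] [cite: SkinnerZhang2014, Thm. 1.1 (a)–(e) and Thm. 1.2 (§1 pp. 1–2)]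
[cite: WZhang2014, Remark 5 and Thm. 10.2] [cite: McCallumLMS1991, §5 Cor. 5.6] -/
theorem kolyvaginFramesHLAt_of_skinnerZhang_OPEN
    (W : WeierstrassCurve ℚ) [W.IsElliptic] [W.IsGloballyMinimal] [NeZero (W.conductorNorm ℤ)]
    (p : ℕ) [hp : Fact p.Prime]
    (hSZ : SkinnerZhang2014.thm1_2_padicVal_bsd_rankOne_OPEN)
    (hGZ : ∀ (K : Type) [Field K] [NumberField K], gross_zagier (W.conductorNorm ℤ) W K)
    (hKo : ∀ (K : Type) [Field K] [NumberField K], kolyvagin (W.conductorNorm ℤ) W K)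
    (hSk : Skinner2016.thmC_padicValRat_bsd_rank_zero)
    (hGZK : rank_eq_analyticRank_of_analyticRank_le_one) (hmod : hasEntireLFunction_rat)
    (hrec : ∀ (K : Type) [Field K] [NumberField K], heegnerPointOfConductor_one_galoisConj (W.conductorNorm ℤ) W K)
    (h1 : ∀ (K : Type) [Field K] [NumberField K],
      phi_heegnerPointOfConductor_mem_range_map_ringClassField (W.conductorNorm ℤ) W K)
    (h2 : ∀ (K : Type) [Field K] [NumberField K], exists_generator_ringClassGalOver K)
    (hMcU : McCallum1991_padicValNat_card_sha_primary_add_le_of_globalDivisibility)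
    (hX : ClassX11b W p) (hp5 : 5 ≤ p) (hHyp : SkinnerZhang2014.Hypotheses W p)
    (htam : ¬ p ∣ W.tamagawaProduct) :
    ∀ (K : Type) [Field K] [NumberField K]
      (Dt : ModularParametrizationData W (W.conductorNorm ℤ)) (β : ℤ) (ι : K →+* ℂ),
      IsImaginaryQuadratic K → Odd (NumberField.discr K) →
      SatisfiesHeegnerHypothesis (W.conductorNorm ℤ) K →
      (W.quadraticTwist (NumberField.discr K : ℚ)).entireLFunction 1 ≠ 0 →
      NumberField.discr K ≠ -3 →
      (4 * (W.conductorNorm ℤ : ℤ)) ∣ β ^ 2 - NumberField.discr K → ¬ (p : ℤ) ∣ Dt.c →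
      ∃ (n : ℕ) (d : KolyvaginHeegnerData Dt β ι n),
        KolyvaginDescent.KolSupp (Zhang2014.IsKolyvaginPrime (W.conductorNorm ℤ) W K p) n ∧
          d.kolyvaginClass hp.out 1 ≠ 0 := by
  intro K _ _ Dt β ι hK hodd hH hLt h3 hβ hc
  have hram : Ram W p := hHyp.exists_ramified_ne
  have hbsd : BSDp W p := bsdp_of_skinnerZhang_OPEN W p hSZ hGZK hp5 hHyp hX.1
  exact kolyvaginClass_one_ne_zero_of_bsdp_of_hlFrame_of_five_le W K Dt β ι p (hGZ K) (hKo K) hSk hGZK hmod (hrec K)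
    (h1 K) (h2 K) hMcU hX hp5 hram htam hK hodd hH hLt h3 hβ hc hbsd

end Summit.BirchSwinnertonDyer.Rank1Residual.X11b.Three.Koly

end
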